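import Summits.Ventures.CertifiedManyBodySolver.Upper.UMPSPolarTensor

/-!
# Composition of Bellman (U1) certificates across a cell of column types

HONEST FRAMING: first certified bounds; not a superconductivity verdict; every number certified or
labelled float.  Design memo HOME/hubbard-upper-plane-1/DESIGN-U3-BDPLANE-OPTIMISER.md §2.1/§9 item L5′.

The tensor-side Theorem U1 (`re_sum_star_mpsOpen_dotProduct_bondSum_mulVec_le`) is stated for ONE
uniform tensor `A` and ONE dual `Z`.  A strip/plane state whose column map cycles through several column
types `A₁, A₂, …` (untwisted antiferromagnetic period 2; a 16-column stripe cell) is certified by BLOCKING the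
cell into one super-column — but the blocked Bellman operator pulls every term back to the blocked cut, so
its exact cone would be a whole cell deep.  This file shows that blocking costs NOTHING on the certificate
side: per-column-type Bellman inequalities with position-dependent duals `Z₁, Z₂` COMPOSE into the blocked
inequality with the summed constant, using only that the Heisenberg map `Φ(B) = Σ_s (A s)ᴴ B (A s)` of a
left-isometric tensor is positive (`heisenberg_posSemidef`) and unital (`heisenberg_one` of `UMPSPolarTensor`
with `gram A = 1`):
  `c₁·1 − (Y₁ + Φ₁(Z₂) − Z₁) ⪰ 0`,  `c₂·1 − (Y₂ + Φ₂(Z₁) − Z₂) ⪰ 0`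
  `⟹ (c₁ + c₂)·1 − (Y₁ + Φ₁(Y₂) + Φ₁(Φ₂(Z₁)) − Z₁) ⪰ 0`   (`posSemidef_bellman_compose`),
and `Φ₁ ∘ Φ₂` is the Heisenberg map of the blocked tensor `S ↦ A₂ S.2 · A₁ S.1` (`heisenberg_blockTensor`),
which is again left-isometric (`blockTensor_isometry`).  So the small per-column cones are what is computed
and certified; the blocked U1 theorem is what is applied.  Iterating the lemma handles any cell length.
Elementary (average-cost dynamic programming / telescoping); no claim about the Hubbard model.
-/

noncomputable section

open Matrix Finset
open scoped ComplexOrder BigOperators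

namespace Summit.Ventures.CertifiedManyBodySolver.Upper

open Literature.MathematicalPhysics.QuantumLattice

variable {q q₁ q₂ D : ℕ}

/-- The Heisenberg map of any tensor preserves positive semidefiniteness:
`M ⪰ 0 ⟹ Σ_s (A s)ᴴ M (A s) ⪰ 0`. -/
theorem heisenberg_posSemidef (A : MPSTensor q D) {M : Matrix (Fin D) (Fin D) ℂ} (hM : M.PosSemidef) :
    (heisenberg A M).PosSemidef := by
  unfold heisenberg
  refine Finset.sum_induction _ (fun X : Matrix (Fin D) (Fin D) ℂ => X.PosSemidef)
    (fun a b ha hb => ha.add hb) Matrix.PosSemidef.zero ?_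
  intro s _
  exact hM.conjTranspose_mul_mul_same (A s)

/-- The Heisenberg map is additive. -/
theorem heisenberg_add (A : MPSTensor q D) (B C : Matrix (Fin D) (Fin D) ℂ) :
    heisenberg A (B + C) = heisenberg A B + heisenberg A C := by
  unfold heisenberg
  simp only [Matrix.mul_add, Matrix.add_mul, Finset.sum_add_distrib]

/-- **L5′: composition of Bellman certificates.** For tensors `A₁, A₂` with `A₁` left-isometric,
matrices `Y₁, Y₂` (bond images of the two column types' windows), position-dependent duals `Z₁, Z₂` and
reals `c₁, c₂`: the two per-column Bellman inequalities imply the blocked one with constant `c₁ + c₂`,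
the composed channel `Φ₁ ∘ Φ₂` and the dual `Z₁`.  Proof: the target equals
`[c₁·1 − (Y₁ + Φ₁ Z₂ − Z₁)] + Φ₁[c₂·1 − (Y₂ + Φ₂ Z₁ − Z₂)]`, a sum of two PSD matrices. -/
theorem posSemidef_bellman_compose {A₁ : MPSTensor q₁ D} (hA₁ : ∑ s, (A₁ s)ᴴ * A₁ s = 1)
    (A₂ : MPSTensor q₂ D) (Y₁ Y₂ Z₁ Z₂ : Matrix (Fin D) (Fin D) ℂ) {c₁ c₂ : ℝ}
    (h₁ : ((c₁ : ℂ) • (1 : Matrix (Fin D) (Fin D) ℂ) - (Y₁ + heisenberg A₁ Z₂ - Z₁)).PosSemidef)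
    (h₂ : ((c₂ : ℂ) • (1 : Matrix (Fin D) (Fin D) ℂ) - (Y₂ + heisenberg A₂ Z₁ - Z₂)).PosSemidef) :
    (((c₁ + c₂ : ℝ) : ℂ) • (1 : Matrix (Fin D) (Fin D) ℂ) -
      (Y₁ + heisenberg A₁ Y₂ + heisenberg A₁ (heisenberg A₂ Z₁) - Z₁)).PosSemidef := by
  have hG : gram A₁ = 1 := hA₁
  have hΦ := heisenberg_posSemidef A₁ h₂
  rw [heisenberg_sub, heisenberg_smul, heisenberg_one, hG, heisenberg_sub, heisenberg_add] at hΦ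
  have hsum := h₁.add hΦ
  convert hsum using 1
  push_cast
  rw [add_smul]
  abel

/-- The blocked tensor of a cell of two column types, `S = (s₁, s₂) ↦ A₂ s₂ · A₁ s₁`
(physical index `finProdFinEquiv (s₁, s₂) : Fin (q₁ q₂)`), ordered so that its Heisenberg map is
`Φ₁ ∘ Φ₂` (`heisenberg_blockTensor`). -/
def blockTensor (A₁ : MPSTensor q₁ D) (A₂ : MPSTensor q₂ D) : MPSTensor (q₁ * q₂) D :=
  fun S => A₂ (finProdFinEquiv.symm S).2 * A₁ (finProdFinEquiv.symm S).1

/-- The Heisenberg map of the blocked tensor is the composition `Φ₁ ∘ Φ₂`. -/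
theorem heisenberg_blockTensor (A₁ : MPSTensor q₁ D) (A₂ : MPSTensor q₂ D)
    (B : Matrix (Fin D) (Fin D) ℂ) :
    heisenberg (blockTensor A₁ A₂) B = heisenberg A₁ (heisenberg A₂ B) := by
  unfold heisenberg blockTensor
  rw [← Equiv.sum_comp finProdFinEquiv, Fintype.sum_prod_type]
  simp only [Equiv.symm_apply_apply, conjTranspose_mul, Finset.mul_sum, Finset.sum_mul]
  refine Finset.sum_congr rfl fun s₁ _ => Finset.sum_congr rfl fun s₂ _ => ?_
  simp only [Matrix.mul_assoc]

/-- The blocked tensor of two left-isometric tensors is left-isometric. -/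
theorem blockTensor_isometry {A₁ : MPSTensor q₁ D} {A₂ : MPSTensor q₂ D}
    (hA₁ : ∑ s, (A₁ s)ᴴ * A₁ s = 1) (hA₂ : ∑ s, (A₂ s)ᴴ * A₂ s = 1) :
    ∑ S, (blockTensor A₁ A₂ S)ᴴ * blockTensor A₁ A₂ S = 1 := by
  have hG₁ : gram A₁ = 1 := hA₁
  have hG₂ : gram A₂ = 1 := hA₂
  have h := heisenberg_blockTensor A₁ A₂ 1
  rw [heisenberg_one, heisenberg_one, hG₂, heisenberg_one, hG₁] at h
  exact h

end Summit.Ventures.CertifiedManyBodySolver.Upper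

end
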